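import Summits.BirchSwinnertonDyer.BirchSwinnertonDyer.Theorems.EisensteinDepletionAtTwoStarDoorFivePrints
import Literature.NumberTheory.EllipticCurves.ManinConstantDeuringTwistProofs
import HarnessLib

/-!
# Line `star` on crux E1M (stmt-BirchSwinnertonDyer-20341): THE END-STATE DOOR, v15 — E1M `DepletedLambdaLawAtTwoMod` (all levels) from FOUR named
# published facts, BY NAME (lead star-p1 GEN 19)

GEN 19's v14 door (Theorems/…StarDoorFivePrints) took FIVE named facts.  One of them, Edixhoven 1991 Prop. 2 in lattice form
(`edixhoven_optimalManinConstant_integral`: the scale `q` with `Λ_{W₀} = q·Λ_f` is an integer), is a TREE THEOREM —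
`Literature.NumberTheory.EllipticCurves.ModularForms.edixhoven_optimalManinConstant_integral_holds` (Literature/…/ManinConstantDeuringTwistProofs: prime by
prime through the formal group; good/multiplicative primes, additive `p ≥ 5`, additive `3` by the Legendre twist, additive `2` by the Deuring twist) — so it is
DISCHARGED here by name.  Hence

  E1M ⇐ { (F) cusp images reduce into the identity component (CES 2003 §6.1.2 / Igusa–Katz–Mazur 12.6 / ATAEC IV.9.1),
          the optimal `Γ₁(N)`-datum (CES 2003 §6.1 / Stevens 1989),  Abbes–Ullmo 1996 Thm A,  unbounded denominators (Calegari–Dimitrov–Tang 2025) }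
        — modularity being E1M's own hypothesis.

* `starOptB_of_fourPrints` — `StarOptB` (aside item 24445, all levels) from three of the prints + modularity;
* `depletedLambdaLawAtTwoMod_of_fourPrints` — E1M from the four prints.

HONEST FRAMING (Barrier B1): a CONDITIONAL result — E1M is proved only modulo the four named facts (hypotheses), none of which is discharged here.  Nothing here
reads `r_an`; E1M as an ITEM, E1M_NSF, the leaf T-r3₂ and BSD are NOT proved (PARTITION D-0054: none — r_an ≥ 2, axis S0; no S0 motion).  No `sorry`, no definition.
-/

set_option linter.dupNamespace false
set_option autoImplicit false

noncomputable section

open scoped Classical MatrixGroups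
open CongruenceSubgroup
open WeierstrassCurve Literature.NumberTheory.EllipticCurves Literature.NumberTheory.EllipticCurves.Greenberg1999
open Literature.NumberTheory.EllipticCurves.ModularForms

namespace Summit.BirchSwinnertonDyer.BirchSwinnertonDyer.Theorems.DepletionAtTwo.SigmaNode

/-- **`StarOptB` (all levels) from three prints + modularity** — `starOptB_of_fivePrints` with Edixhoven's integrality DISCHARGED by the tree theorem
`edixhoven_optimalManinConstant_integral_holds`.  CONDITIONAL on (F), the `Γ₁`-datum and UBD.
[cite: EdixhovenManin1991, Prop. 2] [cite: ConradEdixhovenStein2003, §6.1.2 proof of Lemma 6.1.6 (p. 381)] [cite: CalegariDimitrovTang2025, Thm. 1.0.1] [cite: Stevens1989, §2] -/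
theorem starOptB_of_fourPrints (hnf : exists_isNewformOf) (hF : gamma1Parametrization_cuspImage_nonsingularReduction)
    (hex : exists_optimal_gamma1ParametrizationData)
    (hU : Literature.NumberTheory.Automorphic.CalegariDimitrovTang2025_unboundedDenominators) :
    Summit.BirchSwinnertonDyer.BirchSwinnertonDyer.Theses.EisensteinDepletionAtTwo.StarOptB :=
  starOptB_of_fivePrints hnf hF edixhoven_optimalManinConstant_integral_holds hex hU

/-- **THE END-STATE DOOR OF LINE `star`, v15: E1M `DepletedLambdaLawAtTwoMod` (item 20341, all conductors) from FOUR named published facts, BY NAME** —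
`depletedLambdaLawAtTwoMod_of_fivePrints` with Edixhoven 1991 Prop. 2 DISCHARGED by the tree theorem `edixhoven_optimalManinConstant_integral_holds`.
CONDITIONAL on the four facts; E1M as an item / BSD NOT proved. [cite: EdixhovenManin1991, Prop. 2] [cite: GreenbergVatsal2000, §3 Thm. (3.12), display (28)]
[cite: ConradEdixhovenStein2003, §6.1.2 proof of Lemma 6.1.6 (p. 381)] [cite: AbbesUllmo1996, Thm. A] [cite: CalegariDimitrovTang2025, Thm. 1.0.1] -/
theorem depletedLambdaLawAtTwoMod_of_fourPrints (hF : gamma1Parametrization_cuspImage_nonsingularReduction)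
    (hex : exists_optimal_gamma1ParametrizationData) (hAU : abbesUllmo_not_dvd_maninConstant_of_not_dvd_level)
    (hU : Literature.NumberTheory.Automorphic.CalegariDimitrovTang2025_unboundedDenominators) :
    Summit.BirchSwinnertonDyer.BirchSwinnertonDyer.Theses.EisensteinDepletionAtTwo.DepletedLambdaLawAtTwoMod :=
  depletedLambdaLawAtTwoMod_of_fivePrints hF edixhoven_optimalManinConstant_integral_holds hex hAU hU

end Summit.BirchSwinnertonDyer.BirchSwinnertonDyer.Theorems.DepletionAtTwo.SigmaNode

end
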